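import Literature.AlgebraicGeometry.Resolution.Kuhlmann2019HenselianRationalityLemmas
import Literature.AlgebraicGeometry.Resolution.KnafKuhlmann2009Thm11
import Literature.AlgebraicGeometry.Resolution.HenselianElementsProofs
import HarnessLib

/-!
# Kuhlmann 2019, Thm. 1.3 in arbitrary rank from Prop. 5.6: the proof of Prop. 5.7

Topic: `Literature/AlgebraicGeometry/Resolution` (valued function fields). PROVED assembly of the
named fact `Kuhlmann2019_Thm13_sepClosed` (`Kuhlmann2019HenselianRationality.lean` = F.-V.
Kuhlmann, *Elimination of ramification II: Henselian rationality*, Israel J. Math. 234 (2019) =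
arXiv:1701.05508, Thm. 1.3 for a separably closed ground field `K` of arbitrary rank) from the
five printed ingredients of the proof of **Prop. 5.7** vendored in
`Kuhlmann2019HenselianRationalitySteps.lean`:

* `Kuhlmann2016_Cor38` — [17, Cor. 3.8 / 3.16]: a field of definition `F₀|K₀` of finite rank;
* `Kuhlmann2019_Prop56_sepClosed` — Prop. 5.6: the theorem over base fields of finite rank;
* `Kuhlmann2019_Lemma54` — Lemma 5.4: separating elements with prescribed value;
* `Kuhlmann2010SeparablyDefectlessRational_sepClosed` — [16, Thm. 1]: `K₀(x)` is separably
  defectless for a value-transcendental `x`;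
* `Kuhlmann2010SeparablyDefectlessIffHenselization` — [4, (18.2)] = Kuhlmann 2010, Thm. 2.14:
  so is `K₀(x)^h`;

together with the discharged facts `KnafKuhlmann2009_Lemma21_holds` ([15, Lemma 2.16]: a
separably closed valued field has divisible value group and algebraically closed residue
field), `Kuhlmann2010HenselizationIsHenselian_holds`, `Kuhlmann2010HenselizationImmediate_holds`
(Lemma 2.1 of the source: `F^h|F` immediate, `E^h` henselian). The printed proof (p. 14):

> According to [17, Corollaries 3.8 and 3.16] there exists a separably tame subfield `K₀` of `K`
> of finite rank and a function field `F₀` of transcendence degree 1 over `K₀` with `K₀v = Kv` and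
> `vK/vK₀` torsion free, such that `F = F₀.K` and that `vK₀` is cofinal in `vF₀` … we may also
> assume `F₀|K₀` to be separable. If we are able to show that (5.3) `F₀^h = K₀(x)^h` for some
> `x ∈ F₀ ⊆ F`, then it will follow that `F^h = … = K(x)^h` … If `(F₀|K₀,v)` is immediate, then
> the existence of `x ∈ F₀` satisfying (5.3) follows from Proposition 5.6. Let us assume now that
> `(F₀|K₀,v)` is not immediate. We have: `K₀v ⊆ F₀v ⊆ Fv = Kv = K₀v` … `vF₀/vK₀` is torsion free.
> Therefore, `trdeg F₀|K₀ = 1` is equal to the rational rank of `vF₀/vK₀` and we can employ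
> [17, Corollary 2.3] to obtain that the torsion free group `vF₀/vK₀` is finitely generated. It
> follows that `vF₀ = vK₀ ⊕ ℤvx = vK₀(x)` for a suitable `x ∈ F₀`. By Lemma 5.4 applied with
> `v_Q = v`, we may choose `x` to be a separating element of `F₀|K₀`. As
> `K₀v ⊆ K₀(x)v ⊆ F₀v ⊆ K₀v`, equality holds everywhere. Therefore, `(F₀|K₀(x),v)` is a finite
> immediate and separable extension. By Lemma 2.1, the same holds for `F₀^h|K₀(x)^h`. According
> to [16, Theorem 1], `(K₀(x),v)` is a separably defectless field, and the same is true for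
> `(K₀(x)^h,v)` by [4, Theorem (18.2)]. Hence the extension `F₀^h|K₀(x)^h` must be trivial.

For a separably closed `K` the relative algebraic closure `K₀` is separably closed, which gives
"`K₀v = Kv`, `vK/vK₀` torsion free" directly (module docstring of the Steps file). The finite
generation of `vF₀/vK₀` ([17, Cor. 2.3]) is obtained here from the same two facts [16, Thm. 1]
and [4, (18.2)]: for a separating value-transcendental `x ∈ F₀`, `F₀.K₀(x)^h | K₀(x)^h` is finite
separable with `f = 1`, so its degree is `e = (v(F₀.K₀(x)^h) : vK₀(x)^h) < ∞`, and a torsion free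
group containing `ℤ·vx` with finite index is cyclic (`exists_value_generator`).

## Content (PROVED)

* `prop57_core` — for `K₀ ≤ F₀` as above and a separating value-transcendental `y ∈ F₀`:
  `K₀(y)^h` is henselian and separably defectless, `E = F₀.K₀(y)^h` is finite separable over it
  with `Ev = K₀(y)^h v`, and the values of `E` are values of `F₀`.
* `Kuhlmann2019_Thm13_sepClosed.of_prop56` — **Thm. 1.3 (separably closed `K`, arbitrary
  rank) from the five facts**; `KnafKuhlmann2009_Thm38_sepClosed.of_prop56` — hence
  Knaf–Kuhlmann 2009, Thm. 3.8 (Hensel-root form) from the same five facts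
  (`KuhlmannNovacoski2014_Thm12_holds`).

## Sources

* F.-V. Kuhlmann, Israel J. Math. 234 (2019) = arXiv:1701.05508: Lemma 2.1, Lemma 5.4,
  Prop. 5.6, Prop. 5.7 (pp. 12–14); its references [4] Endler, [15] Kuhlmann 2004, [16]
  Kuhlmann 2010, [17] Kuhlmann 2016.
-/

noncomputable section

open IsLocalRing

namespace Literature.AlgebraicGeometry.Resolution

universe u

variable {Ω : Type u} [Field Ω]

/-! ### Separably closed valued subfields -/

section SepClosed

variable [IsAlgClosed Ω] (V : ValuationSubring Ω)

/-- **Knaf–Kuhlmann 2009, Lemma 2.1 (= [15, Lemma 2.16] of Kuhlmann 2019) for a separably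
closed, non-trivially valued subfield `K₀`** ("As `K` is separable-algebraically closed, it
follows that `vK` is divisible and `Kv` is algebraically closed", proof of Prop. 5.2): `vK₀` is
divisible and `K₀v` is algebraically closed. PROVED from `KnafKuhlmann2009_Lemma21_holds` (the
elements separable over `K₀` are those of `K₀`, `mem_of_isSeparable_of_isSepClosed`).
[cite: KnafKuhlmann2009, Lemma 2.1] -/
theorem divisible_and_isAlgClosed_resField_of_isSepClosed (K₀ : Subfield Ω) [IsSepClosed K₀]
    (hnt : ∃ c ∈ K₀, c ≠ 0 ∧ V.valuation c ≠ 1) :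
    (∀ b ∈ K₀, b ≠ 0 → ∀ n : ℕ, n ≠ 0 → ∃ a ∈ K₀, V.valuation (a ^ n) = V.valuation b) ∧
      IsAlgClosed (resField V K₀) := by
  have hL : ∀ x : Ω, x ∈ K₀ ↔ IsSeparable K₀ x := fun x =>
    ⟨fun hx => isSeparable_algebraMap (⟨x, hx⟩ : K₀), mem_of_isSeparable_of_isSepClosed K₀⟩
  have hntV : ∃ a ∈ K₀, a ∉ V := by
    obtain ⟨c, hcK₀, hc0, hc1⟩ := hnt
    rcases lt_or_gt_of_ne hc1 with hlt | hgt
    · refine ⟨c⁻¹, K₀.inv_mem hcK₀, fun hV => ?_⟩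
      have := (V.valuation_le_one_iff _).mpr hV
      rw [map_inv₀, inv_le_one₀ ((Valuation.pos_iff _).mpr hc0)] at this
      exact absurd hlt (not_lt.mpr this)
    · exact ⟨c, hcK₀, fun hV => absurd hgt (not_lt.mpr ((V.valuation_le_one_iff c).mpr hV))⟩
  obtain ⟨hdiv, -, -, hres⟩ := KnafKuhlmann2009_Lemma21_holds Ω V K₀ K₀ hL hntV
  exact ⟨hdiv, hres⟩

end SepClosed

/-! ### The core step: `F₀.K₀(y)^h` over `K₀(y)^h` for a separating value-transcendental `y` -/

section Core

variable [IsAlgClosed Ω] (V : ValuationSubring Ω)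

/-- **The core of the non-immediate case of Prop. 5.7.** For `K₀ ≤ F₀` with `K₀` separably
closed, `F₀|K₀` finitely generated, `vK₀` cofinal in `vF₀`, `F₀v = K₀v`, and a separating
element `y ∈ F₀` value-transcendental over `K₀`: with `L = K₀(y)`, `L^h` its henselization and
`E = F₀.L^h`, the field `L^h` is henselian (`Kuhlmann2010HenselizationIsHenselian_holds`) and
separably defectless ([16, Thm. 1] and [4, (18.2)], the two named facts), `E|L^h` is finite
(generated by the generators of `F₀`, integral over `L^h`) and separable, `Ev = L^h v`
("`K₀v ⊆ K₀(x)v ⊆ F₀v ⊆ K₀v`"), and every value of `E ≤ F₀^h` is a value of `F₀` (Lemma 2.1: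
`F₀^h|F₀` immediate, `Kuhlmann2010HenselizationImmediate_holds`).
[cite: Kuhlmann2019, Prop. 5.7 (proof)] -/
theorem prop57_core (hGST : Kuhlmann2010SeparablyDefectlessRational_sepClosed.{u})
    (h214 : Kuhlmann2010SeparablyDefectlessIffHenselization.{u})
    {K₀ F₀ : Subfield Ω} (hK₀ : IsSepClosed K₀) (hK₀F₀ : K₀ ≤ F₀) (hfg₀ : FGOver K₀ F₀)
    (hcof₀ : IsValueCofinal V K₀ F₀) (hresF₀ : resField V F₀ ≤ resField V K₀)
    {y : Ω} (hyF₀ : y ∈ F₀) (hyVT : IsValueTranscendentalOver V K₀ y)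
    (hysep : ∀ z ∈ F₀, IsSeparable (IntermediateField.adjoin K₀ ({y} : Set Ω)) z)
    (L Lh E : Subfield Ω) (hL : L = Subfield.closure ((K₀ : Set Ω) ∪ {y}))
    (hLh : Lh = henselization V L) (hE : E = F₀ ⊔ Lh) :
    IsHenselianField Lh (V.comap (algebraMap Lh Ω)) ∧
      IsSeparablyDefectlessField Lh (V.comap (algebraMap Lh Ω)) ∧
      0 < Subfield.relfinrank Lh E ∧ (∀ z ∈ E, IsSeparable Lh z) ∧
      resField V E ≤ resField V Lh ∧
      (∀ b ∈ E, b ≠ 0 → ∃ b₀ ∈ F₀, b₀ ≠ 0 ∧ V.valuation b = V.valuation b₀) := by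
  subst hL hLh hE
  set L : Subfield Ω := Subfield.closure ((K₀ : Set Ω) ∪ {y}) with hL
  have hK₀L : K₀ ≤ L := fun c hc => Subfield.subset_closure (Or.inl hc)
  have hyL : y ∈ L := Subfield.subset_closure (Or.inr rfl)
  have hLF₀ : L ≤ F₀ :=
    Subfield.closure_le.mpr (Set.union_subset hK₀F₀ (Set.singleton_subset_iff.mpr hyF₀))
  have hLLh : L ≤ henselization V L := le_henselization V L
  have hH := Kuhlmann2010HenselizationIsHenselian_holds.{u}
  have hI := Kuhlmann2010HenselizationImmediate_holds.{u}
  -- `E ≤ F₀^h`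
  have hEF₀h : F₀ ⊔ henselization V L ≤ henselization V F₀ :=
    sup_le (le_henselization V F₀) (henselization_mono V hH hLF₀)
  -- henselian, separably defectless
  have hhens : IsHenselianField (henselization V L)
      (V.comap (algebraMap (henselization V L) Ω)) := hH Ω V L
  have hsdL : IsSeparablyDefectlessField L (V.comap (algebraMap L Ω)) :=
    hGST Ω V K₀ y hK₀ hyVT (hcof₀.mono le_rfl hLF₀)
  have hsd := (h214 Ω V L).mp hsdL
  -- `E = L^h(s₀)` for the generators `s₀` of `F₀|K₀`
  obtain ⟨s₀, hs₀⟩ := hfg₀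
  have hs₀F₀ : (↑s₀ : Set Ω) ⊆ F₀ := fun z hz => hs₀ ▸ Subfield.subset_closure (Or.inr hz)
  have hEeq : F₀ ⊔ henselization V L =
      Subfield.closure ((henselization V L : Set Ω) ∪ ↑s₀) := by
    refine le_antisymm (sup_le ?_ fun z hz => Subfield.subset_closure (Or.inl hz))
      (Subfield.closure_le.mpr (Set.union_subset
        (fun z hz => (le_sup_right : henselization V L ≤ F₀ ⊔ henselization V L) hz)
        fun z hz => (le_sup_left : F₀ ≤ F₀ ⊔ henselization V L) (hs₀F₀ hz)))
    rw [← hs₀]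
    exact Subfield.closure_le.mpr (Set.union_subset
      (fun z hz => Subfield.subset_closure (Or.inl ((hK₀L.trans hLLh) hz)))
      fun z hz => Subfield.subset_closure (Or.inr hz))
  have hsepLh : ∀ z ∈ (↑s₀ : Set Ω), IsSeparable (henselization V L) z := fun z hz => by
    have h1 : IsSeparable L z := by
      rw [hL, isSeparable_closure_iff]
      exact hysep z (hs₀F₀ hz)
    exact isSeparable_of_subfield_le hLLh h1
  refine ⟨hhens, hsd, ?_, ?_, ?_, ?_⟩
  · rw [hEeq]
    exact relfinrank_closure_pos _ s₀ fun z hz => (hsepLh z (Finset.mem_coe.mpr hz)).isIntegral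
  · intro z hz
    rw [hEeq] at hz
    exact isSeparable_of_mem_closure hsepLh hz
  · exact (resField_mono V hEF₀h).trans (((hI Ω V F₀).2.trans hresF₀).trans
      (resField_mono V (hK₀L.trans hLLh)))
  · intro b hb hb0
    obtain ⟨b₀, hb₀F₀, hbb₀⟩ := (hI Ω V F₀).1 b (hEF₀h hb) hb0
    refine ⟨b₀, hb₀F₀, fun h0 => hb0 ?_, hbb₀⟩
    rw [h0, map_zero, map_eq_zero] at hbb₀
    exact hbb₀

end Core

/-! ### Thm. 1.3 (separably closed `K`, arbitrary rank) from Prop. 5.6 -/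

section Assembly

/-- **Kuhlmann 2019, Thm. 1.3 for a separably closed ground field of arbitrary rank (= Prop.
5.7 in that case), from Prop. 5.6 (finite rank) and the ingredients of the printed proof of
Prop. 5.7**: [17, Cor. 3.8/3.16] (`Kuhlmann2016_Cor38`), Lemma 5.4 (`Kuhlmann2019_Lemma54`),
[16, Thm. 1] (`Kuhlmann2010SeparablyDefectlessRational_sepClosed`) and [4, (18.2)]
(`Kuhlmann2010SeparablyDefectlessIffHenselization`). PROVED along the print (module
docstring): field of definition `F₀|K₀` with `c ∈ K₀` of value `≠ 1`; `K₀` is separably closed,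
so `vK₀` is divisible, `K₀v` is algebraically closed, `Kv = K₀v` and `vK/vK₀` is torsion free;
if `F₀|K₀` is immediate, Prop. 5.6; otherwise a value of `F₀` outside `vK₀` is
value-transcendental, Lemma 5.4 makes it the value of a separating `x`, the degree of
`F₀.K₀(x)^h | K₀(x)^h` is its ramification index `e`, `vF₀ = vK₀ ⊕ ℤvx'` for some `x' ∈ F₀`
(`exists_value_generator`), Lemma 5.4 again gives a separating `x''` of the same value, and then
`F₀.K₀(x'')^h | K₀(x'')^h` is immediate, hence trivial; finally `F = F₀.K ≤ K(x'')^h`.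
[cite: Kuhlmann2019, Thm. 1.3 and Prop. 5.7] -/
theorem Kuhlmann2019_Thm13_sepClosed.of_prop56 (h38 : Kuhlmann2016_Cor38.{u})
    (h56 : Kuhlmann2019_Prop56_sepClosed.{u}) (h54 : Kuhlmann2019_Lemma54.{u})
    (hGST : Kuhlmann2010SeparablyDefectlessRational_sepClosed.{u})
    (h214 : Kuhlmann2010SeparablyDefectlessIffHenselization.{u}) :
    Kuhlmann2019_Thm13_sepClosed.{u} := by
  intro Ω _ _ V K F hK hKF hfg hsep h1 himm
  haveI := hK
  obtain ⟨t, htF, ht, halg⟩ := h1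
  -- (1) `v` is non-trivial on `K`
  have htK : t ∉ K := fun h => ht (isAlgebraic_algebraMap (⟨t, h⟩ : K))
  obtain ⟨c, hcK, hc0, hc1⟩ := exists_valuation_ne_one_of_isImmediateOver V hKF himm htF htK
  -- (2) a field of definition of finite rank containing `c`
  obtain ⟨K₀, F₀, hK₀K, hSK₀, hrac, hrank, hresalg, hK₀F₀, hF₀F, htF₀, hfg₀, halg₀, hsup, hsep₀,
      hcof₀⟩ := h38 Ω V K F t {c} hKF hfg htF ht halg (by simpa using hcK)
  have hcK₀ : c ∈ K₀ := hSK₀ (by simp)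
  replace hsep₀ := hsep₀ hsep
  replace hcof₀ := hcof₀ (IsValueCofinal.of_isImmediateOver himm)
  -- (3) `K₀` is separably closed; `vK₀` divisible, `K₀v` algebraically closed
  haveI hK₀ : IsSepClosed K₀ := isSepClosed_of_relAlgClosed hK₀K hrac
  obtain ⟨hdiv, hres⟩ :=
    divisible_and_isAlgClosed_resField_of_isSepClosed V K₀ ⟨c, hcK₀, hc0, hc1⟩
  haveI := hres
  -- `Kv = K₀v`
  have hresK : resField V K ≤ resField V K₀ := fun r hr =>
    mem_of_isAlgebraic_of_isAlgClosed_subfield (resField V K₀) (hresalg r hr)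
  -- `vK/vK₀` is torsion free, also for the values of `F` (which are values of `K`)
  have htfK : ∀ a ∈ K, a ≠ 0 → ∀ n : ℕ, 0 < n → (∃ b ∈ K₀, V.valuation a ^ n = V.valuation b) →
      ∃ b ∈ K₀, V.valuation a = V.valuation b := by
    rintro a - ha0 n hn ⟨b, hbK₀, hab⟩
    have hb0 : b ≠ 0 := by
      rintro rfl
      rw [map_zero, pow_eq_zero_iff hn.ne', map_eq_zero] at hab
      exact ha0 hab
    obtain ⟨a', ha'K₀, ha'⟩ := hdiv b hbK₀ hb0 n hn.ne'
    refine ⟨a', ha'K₀, valuation_eq_of_pow_eq V hn.ne' ?_⟩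
    rw [hab, ← ha', map_pow]
  have htfF : ∀ b ∈ F, b ≠ 0 → ∀ n : ℕ, 0 < n → (∃ c ∈ K₀, V.valuation b ^ n = V.valuation c) →
      ∃ c ∈ K₀, V.valuation b = V.valuation c := by
    rintro b hbF hb0 n hn ⟨c', hc'K₀, hbc'⟩
    obtain ⟨a, haK, hba⟩ := himm.1 b hbF hb0
    have ha0 : a ≠ 0 := by
      rintro rfl
      rw [map_zero, map_eq_zero] at hba
      exact hb0 hba
    obtain ⟨b', hb'K₀, hab'⟩ := htfK a haK ha0 n hn ⟨c', hc'K₀, by rw [← hba]; exact hbc'⟩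
    exact ⟨b', hb'K₀, hba.trans hab'⟩
  have ht₀ : Transcendental K₀ t := fun h => ht (isAlgebraic_of_subfield_le hK₀K h)
  by_cases hI : IsImmediateOver V K₀ F₀
  · -- (4) the immediate case: Prop. 5.6
    obtain ⟨x, hxF₀, -, hle⟩ :=
      h56 Ω V K₀ F₀ hK₀ hrank hK₀F₀ hfg₀ hsep₀ ⟨t, htF₀, ht₀, halg₀⟩ hI
    exact exists_transcendental_le_henselization V hK₀K hF₀F hsup hxF₀ hle htF ht
  · -- (5) the non-immediate case: `F₀v = K₀v`, so some value of `F₀` is not in `vK₀`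
    have hresF₀ : resField V F₀ ≤ resField V K₀ :=
      (resField_mono V hF₀F).trans (himm.2.trans hresK)
    have hval : ∃ a ∈ F₀, a ≠ 0 ∧ ∀ b ∈ K₀, V.valuation a ≠ V.valuation b := by
      by_contra hcon
      push Not at hcon
      exact hI ⟨fun a ha ha0 => hcon a ha ha0, hresF₀⟩
    obtain ⟨a, haF₀, ha0, haval⟩ := hval
    have haVT : IsValueTranscendentalOver V K₀ a := fun n hn c' hc' h => by
      obtain ⟨b, hbK₀, hab⟩ := htfF a (hF₀F haF₀) ha0 n hn ⟨c', hc', h⟩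
      exact haval b hbK₀ hab
    have hntF₀ : ∃ a ∈ F₀, a ≠ 0 ∧ V.valuation a ≠ 1 := ⟨c, hK₀F₀ hcK₀, hc0, hc1⟩
    -- Lemma 5.4: a separating `x` with `v(x) = v(a)`
    obtain ⟨x, hxF₀, hxsep, hxval, -⟩ :=
      h54 Ω V K₀ F₀ hK₀F₀ hfg₀ hsep₀ ⟨t, htF₀, ht₀, halg₀⟩ hntF₀ a haF₀ ha0
    have hxVT : IsValueTranscendentalOver V K₀ x := fun n hn c' hc' h =>
      haVT n hn c' hc' (by rw [← hxval]; exact h)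
    -- the extension `E = F₀.K₀(x)^h | K₀(x)^h` has degree `e`
    set L : Subfield Ω := Subfield.closure ((K₀ : Set Ω) ∪ {x}) with hL
    set Lh : Subfield Ω := henselization V L with hLh
    set E : Subfield Ω := F₀ ⊔ Lh with hE
    have hLhE : Lh ≤ E := le_sup_right
    obtain ⟨hhens, hsd, hpos, hsepE, hresE, -⟩ :=
      prop57_core V hGST h214 hK₀ hK₀F₀ hfg₀ hcof₀ hresF₀ hxF₀ hxVT hxsep L Lh E rfl rfl rfl
    have hdeg := relfinrank_eq_relIndex_mul_relfinrank_of_isSeparablyDefectlessField V hLhE hhens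
      hsd hpos hsepE
    rw [residueSubfield_eq_of_resField_le V hLhE hresE, Subfield.relfinrank_self, mul_one] at hdeg
    have he : 0 < (valueSubgroup Lh V).relIndex (valueSubgroup E V) := hdeg ▸ hpos
    -- every `v(b)^e`, `b ∈ F₀^×`, lies in `vK₀(x)^h = vK₀(x) = vK₀·⟨vx⟩`
    have hidx : ∀ b ∈ F₀, b ≠ 0 → ∃ c ∈ K₀, c ≠ 0 ∧ ∃ m : ℤ,
        V.valuation b ^ (valueSubgroup Lh V).relIndex (valueSubgroup E V) =
          V.valuation c * V.valuation x ^ m := by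
      intro b hbF₀ hb0
      obtain ⟨c₁, hc₁Lh, hc₁0, h₁⟩ :=
        exists_valuation_pow_relIndex_eq V (L := Lh) (E := E) ((le_sup_left : F₀ ≤ E) hbF₀) hb0
      obtain ⟨c₂, hc₂L, h₂⟩ := (Kuhlmann2010HenselizationImmediate_holds Ω V L).1 c₁ hc₁Lh hc₁0
      have hc₂0 : c₂ ≠ 0 := by
        rintro rfl
        rw [map_zero, map_eq_zero] at h₂
        exact hc₁0 h₂
      have hc₂' : c₂ ∈ (IntermediateField.adjoin K₀ ({x} : Set Ω)).toSubfield := by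
        rw [adjoin_toSubfield_eq_closure]
        exact hc₂L
      obtain ⟨c₃, hc₃K₀, m, h₃⟩ := exists_valuation_eq_of_mem_adjoin (V := V) hxVT hc₂' hc₂0
      have hc₃0 : c₃ ≠ 0 := by
        rintro rfl
        rw [map_zero, zero_mul, map_eq_zero] at h₃
        exact hc₂0 h₃
      exact ⟨c₃, hc₃K₀, hc₃0, m, by rw [h₁, h₂, h₃]⟩
    -- hence `vF₀ = vK₀ ⊕ ℤvx'`
    obtain ⟨x', hx'F₀, hx'0, hgen'⟩ := exists_value_generator hxF₀ hxVT he hidx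
      fun b hb hb0 n hn h => htfF b (hF₀F hb) hb0 n hn h
    -- Lemma 5.4 again: a separating `x''` with `v(x'') = v(x')`
    obtain ⟨x'', hx''F₀, hx''sep, hx''val, -⟩ :=
      h54 Ω V K₀ F₀ hK₀F₀ hfg₀ hsep₀ ⟨t, htF₀, ht₀, halg₀⟩ hntF₀ x' hx'F₀ hx'0
    have hgen'' : ∀ b ∈ F₀, b ≠ 0 → ∃ c ∈ K₀, c ≠ 0 ∧ ∃ m : ℤ,
        V.valuation b = V.valuation c * V.valuation x'' ^ m := by
      intro b hb hb0
      rw [hx''val]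
      exact hgen' b hb hb0
    have hx''0 : x'' ≠ 0 := by
      intro h0
      rw [h0, map_zero, eq_comm, map_eq_zero] at hx''val
      exact hx'0 hx''val
    have hx''VT : IsValueTranscendentalOver V K₀ x'' := by
      intro n hn c' hc' h
      obtain ⟨b, hbK₀, hb⟩ := htfF x'' (hF₀F hx''F₀) hx''0 n hn ⟨c', hc', h⟩
      obtain ⟨c₁, hc₁K₀, -, m, hm⟩ := hgen'' a haF₀ ha0
      refine haval (c₁ * b ^ m) (K₀.mul_mem hc₁K₀ (zpow_mem hbK₀ m)) ?_
      rw [hm, hb, map_mul, map_zpow₀]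
    -- the extension `E'' = F₀.K₀(x'')^h | K₀(x'')^h` is immediate, hence trivial
    set L'' : Subfield Ω := Subfield.closure ((K₀ : Set Ω) ∪ {x''}) with hL''
    set Lh'' : Subfield Ω := henselization V L'' with hLh''
    set E'' : Subfield Ω := F₀ ⊔ Lh'' with hE''
    have hLhE'' : Lh'' ≤ E'' := le_sup_right
    have hK₀Lh'' : K₀ ≤ Lh'' := fun z hz =>
      le_henselization V L'' (Subfield.subset_closure (Or.inl hz))
    have hx''Lh'' : x'' ∈ Lh'' := le_henselization V L'' (Subfield.subset_closure (Or.inr rfl))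
    obtain ⟨hhens'', hsd'', hpos'', hsepE'', hresE'', hEval''⟩ :=
      prop57_core V hGST h214 hK₀ hK₀F₀ hfg₀ hcof₀ hresF₀ hx''F₀ hx''VT hx''sep L'' Lh'' E''
        rfl rfl rfl
    have hv'' : ∀ b ∈ E'', b ≠ 0 → ∃ c ∈ Lh'', V.valuation b = V.valuation c := by
      intro b hb hb0
      obtain ⟨b₀, hb₀F₀, hb₀0, hbb₀⟩ := hEval'' b hb hb0
      obtain ⟨c₁, hc₁K₀, -, m, hm⟩ := hgen'' b₀ hb₀F₀ hb₀0
      refine ⟨c₁ * x'' ^ m, Lh''.mul_mem (hK₀Lh'' hc₁K₀) (zpow_mem hx''Lh'' m), ?_⟩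
      rw [hbb₀, hm, map_mul, map_zpow₀]
    have hEeq : E'' = Lh'' :=
      eq_of_isSeparablyDefectlessField_of_immediate V hLhE'' hhens'' hsd'' hpos'' hsepE'' hv'' hresE''
    have hF₀le : F₀ ≤ henselization V (Subfield.closure ((K₀ : Set Ω) ∪ {x''})) :=
      (le_sup_left : F₀ ≤ E'').trans hEeq.le
    exact exists_transcendental_le_henselization V hK₀K hF₀F hsup hx''F₀ hF₀le htF ht

/-- **Knaf–Kuhlmann 2009, Thm. 3.8 (separably closed ground field, Hensel-root form) from the
five facts**, through `KnafKuhlmann2009_Thm38_sepClosed.of_henselianRational` and the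
discharged `KuhlmannNovacoski2014_Thm12_holds`: the trust base of Thm. 3.8 — and, along
`KnafKuhlmann2009HenselianRationalityProofs.lean`, of the part of `KnafKuhlmann2009` resting on
it — becomes `{Kuhlmann2016_Cor38, Kuhlmann2019_Prop56_sepClosed, Kuhlmann2019_Lemma54,
Kuhlmann2010SeparablyDefectlessRational_sepClosed, Kuhlmann2010SeparablyDefectlessIffHenselization}`.
[cite: KnafKuhlmann2009, Thm. 3.8] -/
theorem KnafKuhlmann2009_Thm38_sepClosed.of_prop56 (h38 : Kuhlmann2016_Cor38.{u})
    (h56 : Kuhlmann2019_Prop56_sepClosed.{u}) (h54 : Kuhlmann2019_Lemma54.{u})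
    (hGST : Kuhlmann2010SeparablyDefectlessRational_sepClosed.{u})
    (h214 : Kuhlmann2010SeparablyDefectlessIffHenselization.{u}) :
    KnafKuhlmann2009_Thm38_sepClosed.{u} :=
  KnafKuhlmann2009_Thm38_sepClosed.of_henselianRational
    (Kuhlmann2019_Thm13_sepClosed.of_prop56 h38 h56 h54 hGST h214)
    KuhlmannNovacoski2014_Thm12_holds

end Assembly

end Literature.AlgebraicGeometry.Resolution
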